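import Mathlib
import Literature.Topology.Euclidean.BrouwerNormedSpace

/-!
# Route FilamentSkeletonRss · crux `CoreGluing` (stmt-NavierStokesRegularity-15401) — line
  `zero-accretion-selection`, stub `stub_poincareMiranda` (Poincaré–Miranda on `[0,1]^N`)

Helper file (theorems only; lands `--supports stmt-NavierStokesRegularity-15401`) proving the
registered stub `stub_poincareMiranda`: a map `f : [0,1]^N → ℝ^N`, continuous on the cube, with
`f_j ≤ 0` on the face `{p_j = 0}` and `f_j ≥ 0` on the face `{p_j = 1}`, has a zero in the cube.

Proof (folklore reduction to Brouwer): with the clamp `π t := max 0 (min 1 t)` the map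
`g p := (π (p_j − f_j p))_j` is continuous on the cube and maps it into itself. In the sup norm of
`Fin N → ℝ` the cube IS the closed ball of radius `1/2` about `(1/2, …, 1/2)`, so the tree's
`Literature.Topology.Euclidean.Brouwer.exists_fixedPoint_closedBall_of_finiteDimensional` gives a
fixed point `p`. At a fixed point, coordinatewise: if `p_j − f_j p ∈ [0,1]` then `f_j p = 0`; if
`p_j − f_j p < 0` then `p_j = 0 < f_j p`, against the face sign; if `p_j − f_j p > 1` then
`p_j = 1` and `f_j p < 0`, against the other face sign.
-/

set_option linter.dupNamespace false

noncomputable section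

namespace Summit.NavierStokesRegularity.NavierStokesRegularity.Theorems

open Set Function Filter MeasureTheory Real Metric

/-- In the sup norm of `Fin N → ℝ`, the unit cube `[0,1]^N` is the closed ball of radius `1/2`
about its centre `(1/2, …, 1/2)`. -/
theorem poincareMiranda_cube_eq_closedBall (N : ℕ) :
    {p : Fin N → ℝ | ∀ i, p i ∈ Icc (0:ℝ) 1} = closedBall (fun _ : Fin N => (1 / 2 : ℝ)) (1 / 2) := by
  ext p
  simp only [mem_setOf_eq, mem_closedBall]
  rw [dist_pi_le_iff (by norm_num : (0:ℝ) ≤ 1 / 2)]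
  refine forall_congr' fun i => ?_
  rw [Real.dist_eq, abs_sub_le_iff, mem_Icc]
  constructor <;> rintro ⟨h1, h2⟩ <;> constructor <;> linarith

/-- **Poincaré–Miranda on the unit cube.** Registered stub of crux stmt-NavierStokesRegularity-15401,
line `zero-accretion-selection`: a map `f`, continuous on `[0,1]^N`, with `f_j ≤ 0` on `{p_j = 0}`
and `0 ≤ f_j` on `{p_j = 1}` for every `j`, vanishes somewhere in the cube. [folklore; Brouwer
applied to the clamped map `p ↦ (max 0 (min 1 (p_j − f_j p)))_j`] -/
theorem stub_poincareMiranda :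
    ∀ (N : ℕ) (f : (Fin N → ℝ) → Fin N → ℝ), ContinuousOn f {p : Fin N → ℝ | ∀ i, p i ∈ Icc (0:ℝ) 1}
    → (∀ p : Fin N → ℝ, (∀ i, p i ∈ Icc (0:ℝ) 1) → ∀ j, p j = 0 → f p j ≤ 0) → (∀ p : Fin N → ℝ, (∀
    i, p i ∈ Icc (0:ℝ) 1) → ∀ j, p j = 1 → 0 ≤ f p j) → ∃ p : Fin N → ℝ, (∀ i, p i ∈ Icc (0:ℝ) 1) ∧
    ∀ j, f p j = 0 := by
  intro N f hf h0 h1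
  -- the clamped self-map of the cube
  set g : (Fin N → ℝ) → Fin N → ℝ := fun p j => max 0 (min 1 (p j - f p j)) with hg
  have hgcont : ContinuousOn g {p : Fin N → ℝ | ∀ i, p i ∈ Icc (0:ℝ) 1} := by
    refine continuousOn_pi.2 fun j => ?_
    have hfj : ContinuousOn (fun p : Fin N → ℝ => f p j) {p : Fin N → ℝ | ∀ i, p i ∈ Icc (0:ℝ) 1} :=
      (continuousOn_pi.1 hf) j
    have hpj : ContinuousOn (fun p : Fin N → ℝ => p j) {p : Fin N → ℝ | ∀ i, p i ∈ Icc (0:ℝ) 1} :=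
      (continuous_apply j).continuousOn
    exact continuousOn_const.sup (continuousOn_const.inf (hpj.sub hfj))
  have hgmaps : MapsTo g {p : Fin N → ℝ | ∀ i, p i ∈ Icc (0:ℝ) 1}
      {p : Fin N → ℝ | ∀ i, p i ∈ Icc (0:ℝ) 1} := by
    intro p _ i
    exact ⟨le_max_left _ _, max_le zero_le_one (min_le_left _ _)⟩
  rw [poincareMiranda_cube_eq_closedBall] at hgcont hgmaps
  obtain ⟨p, hp, hfix⟩ :=
    Literature.Topology.Euclidean.Brouwer.exists_fixedPoint_closedBall_of_finiteDimensional
      (by norm_num : (0:ℝ) ≤ 1 / 2) hgcont hgmaps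
  rw [← poincareMiranda_cube_eq_closedBall] at hp
  refine ⟨p, hp, fun j => ?_⟩
  have hj : max 0 (min 1 (p j - f p j)) = p j := congr_fun hfix j
  rcases le_or_gt 0 (p j - f p j) with hle | hlt
  · rcases le_or_gt (p j - f p j) 1 with hle1 | hlt1
    · -- interior value of the clamp: `p j - f p j = p j`
      rw [min_eq_right hle1, max_eq_right hle] at hj
      linarith
    · -- clamped at `1`: `p j = 1`, so `0 ≤ f p j`, contradiction
      rw [min_eq_left hlt1.le, max_eq_right (zero_le_one : (0:ℝ) ≤ 1)] at hj
      have := h1 p hp j hj.symm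
      linarith
  · -- clamped at `0`: `p j = 0`, so `f p j ≤ 0`, contradiction
    rw [min_eq_right (by linarith : p j - f p j ≤ 1), max_eq_left hlt.le] at hj
    have := h0 p hp j hj.symm
    linarith

end Summit.NavierStokesRegularity.NavierStokesRegularity.Theorems
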